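import Mathlib
import HarnessLib
import Summits.ValiantsHypothesis.ValiantsHypothesis.Theorems.LacunarySymmetroidMatrixDescartesProductPlusOneSeparatingWeightWindow

/-!
# ValiantsHypothesis / LacunarySymmetroid — crux `MatrixDescartes` (stmt-ValiantsHypothesis-18050, V1),
# LINE (A) «product_plus_one», floor `OneChangeFloorK3`: COHERE(((e : ℝ) + 1) * b j * t ^ (e + 1) + ((e : ℝ) + k + 2) * c j * t ^ (e + k + 2)) FREE RIDERS — the ordered-window law with all three no-dip types

Extension of ✓ `…ProductPlusOneSeparatingWeightWindow` (ordered-window law for pure `(+,−,−)` companies) and of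
✓ `…SeparatingWeightMixed` (one-signed rows are riser-like) to the floor's THIRD row type, the coherent no-dip row `(+,+,−)`
(`a > 0`, `b > 0`, `c < 0`): BEFORE its zero (`g > 0`) such a row satisfies `g·(βc − b) < 0` for EVERY pivot `β ≥ 0`, so it is separated
by every intermediate weight `λ(β, x)` — a FREE RIDER (strict row criterion `sepWeight_row_neg'`, no `θg ≠ 0` needed).  Hence:

* ★★ `sepWeight_noDipWindow_le_one` — K = 3, bottom coupling, normalised chart, EVERY support ratio: on a pole-free window
  `[u,v] ⊂ (0,∞)` of a company of `(+,−,−)`, `(+,+,+)` and `(+,+,−)` rows on which (i) every `(+,+,−)` row is unswitched and (ii) every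
  one-signed row and every SWITCHED `(+,−,−)` row has middle/top ratio `b/c` at least that of every UNSWITCHED `(+,−,−)` row, `X·P′` has at
  most ONE zero.  Compare ✓ `…UnswitchedWindow` (bottom weight `λ = p`: needs EVERY incoherent row unswitched, or ratio ≤ 4): here switched
  incoherent rows of any age and any ratio are allowed, provided the ratio order.

HONEST FRAMING: a window cell of the research floor `stub_oneChangeFloorK3`; NOT the stub, not `MatrixDescartes`; `VP ≠ VNP` is NOT
proved.  No definitions, no named facts, no sorry.
-/

set_option linter.dupNamespace false

namespace Summit.ValiantsHypothesis.ValiantsHypothesis.Theorems.LacunarySymmetroidMatrixDescartes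

namespace ProductPlusOne

open Polynomial Finset
open scoped BigOperators

/-- **Strict row criterion** (no hypothesis on `N`): `0 < p < q`, `X, Y > 0`, `β ≥ 0`, `g·(βc − b) < 0` ⟹ `W(g) < λ(β)·g·N`.
[this file's lemma] -/
theorem sepWeight_row_neg' {p q β a b c X Y : ℝ} (hp : 0 < p) (hpq : p < q) (hX : 0 < X) (hY : 0 < Y) (hβ : 0 ≤ β)
    (hsep : (a + b * X + c * Y) * (β * c - b) < 0) :
    (a + b * X + c * Y) * (p ^ 2 * b * X + q ^ 2 * c * Y) - (p * b * X + q * c * Y) ^ 2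
      < (p ^ 2 * β * X + q ^ 2 * Y) / (p * β * X + q * Y) * ((a + b * X + c * Y) * (p * b * X + q * c * Y)) := by
  have hq : 0 < q := hp.trans hpq
  have hD : 0 < p * β * X + q * Y := by
    have h1 : 0 ≤ p * β * X := by positivity
    have h2 : 0 < q * Y := mul_pos hq hY
    linarith
  have key := sepWeight_row_identity p q β a b c X Y
  have hN2 : 0 ≤ (p * b * X + q * c * Y) ^ 2 := sq_nonneg _
  have hcoef : 0 < p * q * (q - p) * X * Y := by
    have : 0 < q - p := sub_pos.mpr hpq
    positivity
  have hneg : (p * β * X + q * Y) * ((a + b * X + c * Y) * (p ^ 2 * b * X + q ^ 2 * c * Y) - (p * b * X + q * c * Y) ^ 2)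
      - (p ^ 2 * β * X + q ^ 2 * Y) * ((a + b * X + c * Y) * (p * b * X + q * c * Y)) < 0 := by
    rw [key]
    nlinarith [mul_neg_of_pos_of_neg hcoef hsep, mul_nonneg hD.le hN2]
  rw [div_mul_eq_mul_div, lt_div_iff₀ hD]
  linarith

/-- ★★ **THE NO-DIP ORDERED-WINDOW LAW** (K = 3, bottom coupling, normalised chart `g_j = a_j + b_j X^{e+1} + c_j X^{e+k+2}`, EVERY
support; each row incoherent no-dip `(+,−,−)`, one-signed `(+,+,+)` or coherent no-dip `(+,+,−)`): on a pole-free window `[u,v] ⊂ (0,∞)`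
on which every coherent row is unswitched (`g > 0`) and, pointwise, every one-signed row and every switched incoherent row `j` has
`b_i/c_i ≤ b_j/c_j` against every unswitched incoherent row `i`, `X·P′` has at most ONE zero. [this file's theorem] -/
theorem sepWeight_noDipWindow_le_one {m : ℕ} (a b c : Fin m → ℝ) (e k : ℕ)
    (hrows : ∀ j, (0 < a j ∧ b j < 0 ∧ c j < 0) ∨ (0 < a j ∧ 0 < b j ∧ 0 < c j) ∨ (0 < a j ∧ 0 < b j ∧ c j < 0))
    {u v : ℝ} (hu : 0 < u)
    (hfree : ∀ t ∈ Set.Icc u v, ∀ j, (a j + b j * t ^ (e + 1) + c j * t ^ (e + k + 2)) ≠ 0)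
    (hcoh : ∀ t ∈ Set.Icc u v, ∀ j, 0 < b j → c j < 0 → 0 < (a j + b j * t ^ (e + 1) + c j * t ^ (e + k + 2)))
    (hord : ∀ t ∈ Set.Icc u v, ∀ j i, (0 < c j ∨ (c j < 0 ∧ (a j + b j * t ^ (e + 1) + c j * t ^ (e + k + 2)) < 0)) → b i < 0 → c i < 0 → 0 < (a i + b i * t ^ (e + 1) + c i * t ^ (e + k + 2)) →
      b i / c i ≤ b j / c j) :
    ((X * derivative (∏ j, (C (a j) + C (b j) * X ^ (e + 1) + C (c j) * X ^ (e + k + 2))) - C (0 : ℝ) * (∏ j, (C (a j) + C (b j) * X ^ (e + 1) + C (c j) * X ^ (e + k + 2))) : ℝ[X]).roots.toFinset.filter (fun t => u ≤ t ∧ t ≤ v)).card ≤ 1 := by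
  classical
  have hP : ∀ t ∈ Set.Icc u v, (∏ j, (C (a j) + C (b j) * X ^ (e + 1) + C (c j) * X ^ (e + k + 2)) : ℝ[X]).eval t ≠ 0 := by
    intro t ht
    rw [eval_prod, Finset.prod_ne_zero_iff]
    intro j _
    have h := hfree t ht j
    simpa only [eval_add, eval_mul, eval_C, eval_pow, eval_X] using h
  refine sepWeight_window_le_one (fun j => (C (a j) + C (b j) * X ^ (e + 1) + C (c j) * X ^ (e + k + 2))) 0 hu hP (fun t ht _hEt => ?_)
  have ht0 : 0 < t := hu.trans_le ht.1
  set Xv : ℝ := t ^ (e + 1) with hXv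
  set Yv : ℝ := t ^ (e + k + 2) with hYv
  set p : ℝ := (e : ℝ) + 1 with hpdef
  set q : ℝ := (e : ℝ) + k + 2 with hqdef
  have hp : 0 < p := by rw [hpdef]; positivity
  have hpq : p < q := by rw [hpdef, hqdef]; have : (0:ℝ) ≤ k := Nat.cast_nonneg k; linarith
  have hX : 0 < Xv := by rw [hXv]; positivity
  have hY : 0 < Yv := by rw [hYv]; positivity
  -- it suffices to find a pivot `β ≥ 0` with the strict, or the non-strict + `N ≠ 0`, row condition for every row
  suffices hpiv : ∃ β : ℝ, 0 ≤ β ∧ ∀ j, (a j + b j * t ^ (e + 1) + c j * t ^ (e + k + 2)) * (β * c j - b j) < 0 ∨ ((a j + b j * t ^ (e + 1) + c j * t ^ (e + k + 2)) * (β * c j - b j) ≤ 0 ∧ (((e : ℝ) + 1) * b j * t ^ (e + 1) + ((e : ℝ) + k + 2) * c j * t ^ (e + k + 2)) ≠ 0) by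
    obtain ⟨β, hβ, hrow⟩ := hpiv
    refine ⟨(p ^ 2 * β * Xv + q ^ 2 * Yv) / (p * β * Xv + q * Yv), fun _ => 0, by simp, fun j => ?_⟩
    rw [sepWeight_eval_wronskian, sepWeight_eval_theta]
    simp only [eval_add, eval_mul, eval_C, eval_pow, eval_X, zero_mul, sub_zero]
    rcases hrow j with h | h
    · exact sepWeight_row_neg' hp hpq hX hY hβ h
    · exact sepWeight_row_neg hp hpq hX hY hβ h.1 h.2
  -- `θg ≠ 0` for incoherent and one-signed rows
  have hNinc : ∀ j, b j < 0 → c j < 0 → (((e : ℝ) + 1) * b j * t ^ (e + 1) + ((e : ℝ) + k + 2) * c j * t ^ (e + k + 2)) ≠ 0 := by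
    intro j hb hc
    have h1 : ((e : ℝ) + 1) * b j * t ^ (e + 1) < 0 :=
      mul_neg_of_neg_of_pos (mul_neg_of_pos_of_neg (by positivity) hb) (by positivity)
    have h2 : ((e : ℝ) + k + 2) * c j * t ^ (e + k + 2) < 0 :=
      mul_neg_of_neg_of_pos (mul_neg_of_pos_of_neg (by positivity) hc) (by positivity)
    linarith
  have hNone : ∀ j, 0 < b j → 0 < c j → (((e : ℝ) + 1) * b j * t ^ (e + 1) + ((e : ℝ) + k + 2) * c j * t ^ (e + k + 2)) ≠ 0 := by
    intro j hb hc
    have h1 : 0 < ((e : ℝ) + 1) * b j * t ^ (e + 1) := by positivity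
    have h2 : 0 < ((e : ℝ) + k + 2) * c j * t ^ (e + k + 2) := by positivity
    linarith
  have hGone : ∀ j, 0 < a j → 0 < b j → 0 < c j → 0 < (a j + b j * t ^ (e + 1) + c j * t ^ (e + k + 2)) := by
    intro j ha hb hc; positivity
  -- riser-like rows: one-signed, or switched incoherent
  set R : Finset (Fin m) := Finset.univ.filter (fun j => 0 < c j ∨ (c j < 0 ∧ (a j + b j * t ^ (e + 1) + c j * t ^ (e + k + 2)) < 0)) with hR
  by_cases hRne : R.Nonempty
  · obtain ⟨j₀, hj₀, hmin⟩ := R.exists_min_image (fun j => b j / c j) hRne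
    have hj₀' : 0 < c j₀ ∨ (c j₀ < 0 ∧ a j₀ + b j₀ * t ^ (e + 1) + c j₀ * t ^ (e + k + 2) < 0) := (Finset.mem_filter.mp hj₀).2
    have hβpos : 0 < b j₀ / c j₀ := by
      rcases hrows j₀ with h | h | h
      · exact div_pos_of_neg_of_neg h.2.1 h.2.2
      · exact div_pos h.2.1 h.2.2
      · -- a coherent row is never riser-like on this window
        exfalso
        rcases hj₀' with hc | ⟨_, hlt⟩
        · exact absurd hc (not_lt.mpr h.2.2.le)
        · exact absurd hlt (not_lt.mpr (hcoh t ht j₀ h.2.1 h.2.2).le)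
    refine ⟨b j₀ / c j₀, hβpos.le, fun j => ?_⟩
    rcases hrows j with h | h | h
    · -- incoherent row
      rcases lt_or_gt_of_ne (hfree t ht j) with hlt | hgt
      · have hle : b j₀ / c j₀ ≤ b j / c j := hmin j (Finset.mem_filter.mpr ⟨Finset.mem_univ _, Or.inr ⟨h.2.2, hlt⟩⟩)
        have h1 : b j ≤ b j₀ / c j₀ * c j := (le_div_iff_of_neg h.2.2).mp hle
        exact Or.inr ⟨by nlinarith, hNinc j h.2.1 h.2.2⟩
      · have hle : b j / c j ≤ b j₀ / c j₀ := hord t ht j₀ j hj₀' h.2.1 h.2.2 hgt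
        have h1 : b j₀ / c j₀ * c j ≤ b j := (div_le_iff_of_neg h.2.2).mp hle
        exact Or.inr ⟨by nlinarith, hNinc j h.2.1 h.2.2⟩
    · -- one-signed row
      have hle : b j₀ / c j₀ ≤ b j / c j := hmin j (Finset.mem_filter.mpr ⟨Finset.mem_univ _, Or.inl h.2.2⟩)
      have h1 : b j₀ / c j₀ * c j ≤ b j := (le_div_iff₀ h.2.2).mp hle
      have hg := hGone j h.1 h.2.1 h.2.2
      exact Or.inr ⟨by nlinarith, hNone j h.2.1 h.2.2⟩
    · -- coherent row, unswitched: free rider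
      have hg := hcoh t ht j h.2.1 h.2.2
      have hlt : b j₀ / c j₀ * c j - b j < 0 := by nlinarith [h.2.1, h.2.2, hβpos]
      exact Or.inl (mul_neg_of_pos_of_neg hg hlt)
  · -- no riser-like row: pivot = max(0, max over the rows of b/c)
    rcases Nat.eq_zero_or_pos m with hm | hm
    · subst hm
      exact ⟨0, le_rfl, fun j => j.elim0⟩
    obtain ⟨j₁, -, hmax⟩ := Finset.univ.exists_max_image (fun j => max (b j / c j) 0) ⟨⟨0, hm⟩, Finset.mem_univ _⟩
    refine ⟨max (b j₁ / c j₁) 0, le_max_right _ _, fun j => ?_⟩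
    have hnot : ¬ (0 < c j ∨ (c j < 0 ∧ (a j + b j * t ^ (e + 1) + c j * t ^ (e + k + 2)) < 0)) := fun h => hRne ⟨j, Finset.mem_filter.mpr ⟨Finset.mem_univ _, h⟩⟩
    rcases hrows j with h | h | h
    · -- incoherent, hence unswitched here
      have hgt : 0 < (a j + b j * t ^ (e + 1) + c j * t ^ (e + k + 2)) := by
        rcases lt_or_gt_of_ne (hfree t ht j) with hlt | hgt
        · exact absurd (Or.inr ⟨h.2.2, hlt⟩) hnot
        · exact hgt
      have hle : b j / c j ≤ max (b j₁ / c j₁) 0 := (le_max_left _ _).trans (hmax j (Finset.mem_univ _))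
      have h1 : max (b j₁ / c j₁) 0 * c j ≤ b j := (div_le_iff_of_neg h.2.2).mp hle
      exact Or.inr ⟨by nlinarith, hNinc j h.2.1 h.2.2⟩
    · exact absurd (Or.inl h.2.2) hnot
    · -- coherent, unswitched: free rider
      have hg := hcoh t ht j h.2.1 h.2.2
      have hβ : 0 ≤ max (b j₁ / c j₁) 0 := le_max_right _ _
      have hlt : max (b j₁ / c j₁) 0 * c j - b j < 0 := by nlinarith [h.2.1, h.2.2]
      exact Or.inl (mul_neg_of_pos_of_neg hg hlt)

end ProductPlusOne

end Summit.ValiantsHypothesis.ValiantsHypothesis.Theorems.LacunarySymmetroidMatrixDescartes
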